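import Mathlib.RingTheory.Valuation.Discrete.IsDiscreteValuationRing
import Mathlib.RingTheory.DiscreteValuationRing.TFAE
import Literature.NumberTheory.DiophantineGeometry.FunctionFieldDivisorsOrdProofs
import HarnessLib

/-!
# Places of a field extension `F/K`: the `ℤ`-valued valuation of a place (Mathlib's adic
valuation) and the Riemann–Roch space in terms of it

Auxiliary results towards Riemann's theorem `Literature.NumberTheory.DiophantineGeometry.AlgFunctionField.bddAbove_genusSet`
(Stichtenoth, *Algebraic Function Fields and Codes*, 2nd ed. 2009, Prop. 1.4.14), kept in a
sibling file of `FunctionFieldDivisors` (theorems only; no new definitions).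

For a place `v` of `F/K` (a discrete valuation ring `K ⊆ O_v ⊊ F`) the file
`FunctionFieldDivisors` offers two valuations: the abstract `v.valuation = O_v.valuation`
(values in the value group of `O_v`, used to define `L(D)`) and the `ℤ`-valued `v.ord` (defined by
cases, junk value at `0`). Here we use a third, *Mathlib's* `v_P`: the adic valuation of the
maximal ideal of the DVR `O_v` on its fraction field `F`,
`(IsDiscreteValuationRing.maximalIdeal O_v).valuation F : Valuation F ℤᵐ⁰` (written `𝓋_v` in
the docstrings below; multiplicative, `𝓋_v x = exp (-v_P(x))` in Stichtenoth's notation,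
Def. 1.1.12), which carries the full `Valuation` API (ultrametric inequality with equality, sums,
powers; and Mathlib's `valuation_of_algebraMap`, `valuation_lt_one_iff_mem` for elements of `O_v`).
We prove:

* `PlaceOver.adicVal_le_one_iff` : `𝓋_v x ≤ 1 ↔ x ∈ O_v` (Stichtenoth Thm. 1.1.13 (a));
* `PlaceOver.adicVal_uniformizer` : `𝓋_v π_v = exp (-1)` (Def. 1.1.12: `v_P(t) = 1`);
* `PlaceOver.adicVal_eq_exp_neg_ord` : `𝓋_v x = exp (-ord_v x)` for `x ≠ 0` (the three
  valuations agree);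
* `mem_riemannRochSpace_iff_adicVal` : `x ∈ L(D) ↔ ∀ v, 𝓋_v x ≤ exp (D v)`
  (Def. 1.4.4 (`x ∈ L(A) ↔ v_P(x) ≥ -v_P(A)` for all `P`), via `Valuation.IsEquiv` of `𝓋_v` and
  `O_v.valuation`, both having valuation ring `O_v`);
* `PlaceOver.eq_of_le` : distinct places have incomparable valuation rings (a DVR of `F` is a
  maximal proper subring; Stichtenoth Thm. 1.1.12 (c) / proof of Thm. 1.3.1, Step 1).

## References

* H. Stichtenoth, *Algebraic Function Fields and Codes*, 2nd ed., GTM 254, Springer 2009, §1.1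
  (Def. 1.1.12, Thm. 1.1.13), §1.4 (Def. 1.4.4).
-/

noncomputable section

namespace Literature.NumberTheory.DiophantineGeometry.AlgFunctionField

universe u v

variable {K : Type u} {F : Type v} [Field K] [Field F] [Algebra K F]

open IsDiscreteValuationRing WithZero

namespace PlaceOver

variable (v : PlaceOver K F)

/-- `𝓋_v x ≤ 1 ↔ x ∈ O_v`: the valuation ring of the adic valuation of `O_v` is `O_v`
(Stichtenoth Thm. 1.1.13 (a): `O_P = {z | v_P(z) ≥ 0}`; Mathlib
`IsDiscreteValuationRing.exists_lift_of_le_one`). [cite: Stichtenoth2009, Thm. 1.1.13(a)] -/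
theorem adicVal_le_one_iff (x : F) : ((maximalIdeal v.toValuationSubring).valuation F) x ≤ 1 ↔ x ∈ v.toValuationSubring := by
  constructor
  · intro h
    obtain ⟨a, ha⟩ := IsDiscreteValuationRing.exists_lift_of_le_one h
    rw [← ha]
    exact a.2
  · intro h
    have := IsDedekindDomain.HeightOneSpectrum.valuation_le_one (K := F)
      (IsDiscreteValuationRing.maximalIdeal v.toValuationSubring) ⟨x, h⟩
    exact this

/-- `1 < 𝓋_v x ↔ x ∉ O_v` (contrapositive of `adicVal_le_one_iff`). [folklore] -/
theorem one_lt_adicVal_iff (x : F) : 1 < ((maximalIdeal v.toValuationSubring).valuation F) x ↔ x ∉ v.toValuationSubring := by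
  rw [← not_le, adicVal_le_one_iff]

/-- For `a ∈ O_v`: `𝓋_v a = 1 ↔ a` is a unit of `O_v` (Stichtenoth Thm. 1.1.13 (a):
`O_P^× = {z | v_P(z) = 0}`). [cite: Stichtenoth2009, Thm. 1.1.13(a)] -/
theorem adicVal_coe_eq_one_iff (a : v.toValuationSubring) :
    ((maximalIdeal v.toValuationSubring).valuation F) (a : F) = 1 ↔ IsUnit a := by
  have h : ((maximalIdeal v.toValuationSubring).valuation F) (a : F) =
      (maximalIdeal v.toValuationSubring).intValuation a :=
    IsDedekindDomain.HeightOneSpectrum.valuation_of_algebraMap _ a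
  rw [h, IsDedekindDomain.HeightOneSpectrum.intValuation_eq_one_iff]
  change a ∉ IsLocalRing.maximalIdeal v.toValuationSubring ↔ IsUnit a
  rw [IsLocalRing.mem_maximalIdeal, mem_nonunits_iff, not_not]

/-- Units of `O_v` have adic valuation `1`. [folklore] -/
theorem adicVal_unit (u : (v.toValuationSubring)ˣ) : ((maximalIdeal v.toValuationSubring).valuation F) ((u : v.toValuationSubring) : F) = 1 :=
  (v.adicVal_coe_eq_one_iff _).2 u.isUnit

/-- Nonzero constants have adic valuation `1` (Stichtenoth Def. 1.1.9 (5) / Prop. 1.1.5: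
`v_P(a) = 0` for `0 ≠ a ∈ K`). [cite: Stichtenoth2009, Def. 1.1.9(5)] -/
theorem adicVal_algebraMap {c : K} (hc : c ≠ 0) : ((maximalIdeal v.toValuationSubring).valuation F) (algebraMap K F c) = 1 := by
  have h := (v.adicVal_coe_eq_one_iff (algebraMap K v.toValuationSubring c)).2
    ((Ne.isUnit hc).map (algebraMap K v.toValuationSubring))
  simpa using h

/-- Constants have adic valuation `≤ 1` (they lie in `O_v`). [folklore] -/
theorem adicVal_algebraMap_le_one (c : K) : ((maximalIdeal v.toValuationSubring).valuation F) (algebraMap K F c) ≤ 1 :=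
  (v.adicVal_le_one_iff _).2 (v.algebraMap_mem c)

/-- The valuation ring of the adic valuation `𝓋_v` is `O_v`. [folklore] -/
theorem valuationSubring_adicVal :
    ((maximalIdeal v.toValuationSubring).valuation F).valuationSubring = v.toValuationSubring := by
  ext x
  rw [Valuation.mem_valuationSubring_iff, adicVal_le_one_iff]

/-- The abstract valuation `v.valuation = O_v.valuation` of `FunctionFieldDivisors` and the adic
valuation `𝓋_v` are equivalent (both have valuation ring `O_v`;
Mathlib `Valuation.isEquiv_iff_valuationSubring`). [folklore] -/
theorem isEquiv_valuation_adicVal : v.valuation.IsEquiv ((maximalIdeal v.toValuationSubring).valuation F) := by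
  rw [Valuation.isEquiv_iff_valuationSubring, valuationSubring_adicVal]
  exact v.toValuationSubring.valuationSubring_valuation

/-- The chosen uniformizer has adic valuation `exp (-1)` (Stichtenoth Def. 1.1.12: `v_P(t) = 1`
for a prime element `t` of `P`; Mathlib `intValuation_singleton`). [cite: Stichtenoth2009, Def. 1.1.12] -/
theorem adicVal_uniformizer : ((maximalIdeal v.toValuationSubring).valuation F) (v.uniformizer : F) = exp (-1 : ℤ) := by
  have h : ((maximalIdeal v.toValuationSubring).valuation F) (v.uniformizer : F) =
      (maximalIdeal v.toValuationSubring).intValuation v.uniformizer :=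
    IsDedekindDomain.HeightOneSpectrum.valuation_of_algebraMap _ v.uniformizer
  rw [h]
  exact IsDedekindDomain.HeightOneSpectrum.intValuation_singleton _
    v.irreducible_uniformizer.ne_zero v.irreducible_uniformizer.maximalIdeal_eq

/-- The uniformizer is nonzero in `F`. [folklore] -/
theorem uniformizer_ne_zero : (v.uniformizer : F) ≠ 0 := fun h ↦
  v.irreducible_uniformizer.ne_zero (Subtype.ext h)

/-- Powers of the uniformizer realise every value: `𝓋_v (π_v ^ (-n)) = exp n`. [folklore] -/
theorem adicVal_uniformizer_zpow (n : ℤ) : ((maximalIdeal v.toValuationSubring).valuation F) ((v.uniformizer : F) ^ (-n)) = exp n := by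
  rw [map_zpow₀, adicVal_uniformizer, ← exp_zsmul]
  congr 1
  simp

/-- Every value `exp n` is attained by a nonzero element of `F` (namely `π_v ^ (-n)`). [folklore] -/
theorem exists_adicVal_eq_exp (n : ℤ) : ∃ x : F, x ≠ 0 ∧ ((maximalIdeal v.toValuationSubring).valuation F) x = exp n :=
  ⟨(v.uniformizer : F) ^ (-n), zpow_ne_zero _ v.uniformizer_ne_zero,
    v.adicVal_uniformizer_zpow n⟩

/-- For a nonzero `a ∈ O_v`, `𝓋_v a = exp (-addVal a)` (as a natural number): both are read
off from `a = u π_vⁿ` (Stichtenoth Def. 1.1.12; Mathlib `eq_unit_mul_pow_irreducible`,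
`addVal_def`). [cite: Stichtenoth2009, Def. 1.1.12] -/
theorem adicVal_coe_eq_exp_neg_addVal {a : v.toValuationSubring} (ha : a ≠ 0) :
    ((maximalIdeal v.toValuationSubring).valuation F) (a : F) = exp (-((addVal v.toValuationSubring a).toNat : ℤ)) := by
  obtain ⟨n, u, hau⟩ := eq_unit_mul_pow_irreducible ha v.irreducible_uniformizer
  have h1 : addVal v.toValuationSubring a = n :=
    addVal_def a u v.irreducible_uniformizer n hau
  rw [h1, ENat.toNat_coe]
  have h2 : (a : F) = ((u : v.toValuationSubring) : F) * (v.uniformizer : F) ^ n := by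
    rw [hau]; push_cast; rfl
  rw [h2, map_mul, map_pow, adicVal_unit, one_mul, adicVal_uniformizer, ← exp_nsmul]
  congr 1
  simp

/-- **The adic valuation and `ord_v` agree**: `𝓋_v x = exp (-ord_v x)` for `x ≠ 0` (both are
Stichtenoth's `v_P`, Def. 1.1.12; the junk value `ord_v 0 = 0` is excluded). Proof: write
`x = a/b` with `a, b ∈ O_v ∖ {0}` (`exists_mul_eq_of_ne_zero`), use the fraction formula
`ord_eq_sub_of_mul_eq` and `adicVal_coe_eq_exp_neg_addVal`. [cite: Stichtenoth2009, Def. 1.1.12] -/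
theorem adicVal_eq_exp_neg_ord {x : F} (hx : x ≠ 0) : ((maximalIdeal v.toValuationSubring).valuation F) x = exp (-(v.ord x)) := by
  obtain ⟨a, b, ha, hb, hab⟩ := v.exists_mul_eq_of_ne_zero hx
  rw [v.ord_eq_sub_of_mul_eq hx ha hb hab]
  have hbF : (b : F) ≠ 0 := fun h ↦ hb (Subtype.ext h)
  have hx' : x = (a : F) / (b : F) := by
    rw [eq_div_iff hbF, hab]
  rw [hx', map_div₀, v.adicVal_coe_eq_exp_neg_addVal ha, v.adicVal_coe_eq_exp_neg_addVal hb,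
    ← exp_sub]
  congr 1
  ring

/-- `ord_v` in terms of the adic valuation: `ord_v x = -log (𝓋_v x)` for `x ≠ 0`. [folklore] -/
theorem ord_eq_neg_log_adicVal {x : F} (hx : x ≠ 0) : v.ord x = -log (((maximalIdeal v.toValuationSubring).valuation F) x) := by
  rw [v.adicVal_eq_exp_neg_ord hx, log_exp, neg_neg]

/-- **Distinct places have incomparable valuation rings**: if `O_v ⊆ O_w` then `v = w` (a
discrete valuation ring of `F` is a maximal proper subring: Mathlib
`ValuationSubring.eq_of_le_of_ne_top` for rings of Krull dimension `≤ 1`; Stichtenoth, proof of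
Thm. 1.3.1, Step 1, via Thm. 1.1.12 (c)). [cite: Stichtenoth2009, proof of Thm. 1.3.1] -/
theorem eq_of_le {v w : PlaceOver K F} (h : v.toValuationSubring ≤ w.toValuationSubring) :
    v = w :=
  PlaceOver.ext (ValuationSubring.eq_of_le_of_ne_top v.toValuationSubring h w.ne_top)

/-- For distinct places `v ≠ w` there is `x ∈ O_v` with `x ∉ O_w`. [folklore] -/
theorem exists_mem_not_mem {v w : PlaceOver K F} (h : v ≠ w) :
    ∃ x : F, x ∈ v.toValuationSubring ∧ x ∉ w.toValuationSubring := by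
  by_contra! H
  exact h (eq_of_le fun x hx ↦ H x hx)

/-- For distinct places `v ≠ w` there is `x` with `𝓋_v x ≤ 1 < 𝓋_w x`. [folklore] -/
theorem exists_adicVal_le_one_lt {v w : PlaceOver K F} (h : v ≠ w) :
    ∃ x : F, ((maximalIdeal v.toValuationSubring).valuation F) x ≤ 1 ∧ 1 < ((maximalIdeal w.toValuationSubring).valuation F) x := by
  obtain ⟨x, hv, hw⟩ := exists_mem_not_mem h
  exact ⟨x, (v.adicVal_le_one_iff x).2 hv, (w.one_lt_adicVal_iff x).2 hw⟩

end PlaceOver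

/-! ### The Riemann–Roch space in terms of the adic valuations -/

/-- **`L(D)` via `v_P`**: `x ∈ L(D) ↔ 𝓋_v x ≤ exp (D v)` for every place `v`, i.e.
`v_P(x) ≥ -v_P(D)` for all `P` (Stichtenoth Def. 1.4.4), the defining condition of
`riemannRochSpace` (phrased with `O_v.valuation` and `π_v ^ (-D v)`) transported along the
equivalence `PlaceOver.isEquiv_valuation_adicVal` and evaluated with
`PlaceOver.adicVal_uniformizer_zpow`. [cite: Stichtenoth2009, Def. 1.4.4] -/
theorem mem_riemannRochSpace_iff_adicVal (D : Divisor K F) (x : F) :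
    x ∈ riemannRochSpace D ↔ ∀ v : PlaceOver K F, ((maximalIdeal v.toValuationSubring).valuation F) x ≤ exp (D v) := by
  rw [mem_riemannRochSpace_iff]
  refine forall_congr' fun v ↦ ?_
  rw [← map_zpow₀, (v.isEquiv_valuation_adicVal).le_iff_le, v.adicVal_uniformizer_zpow]

/-- Logarithmic form of membership in `L(D)` for `x ≠ 0`: `log (𝓋_v x) ≤ D v`, i.e.
`v_P(x) ≥ -v_P(D)` (Stichtenoth Def. 1.4.4). [cite: Stichtenoth2009, Def. 1.4.4] -/
theorem log_adicVal_le_of_mem {D : Divisor K F} {x : F} (hx : x ∈ riemannRochSpace D)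
    (hx0 : x ≠ 0) (v : PlaceOver K F) : log (((maximalIdeal v.toValuationSubring).valuation F) x) ≤ D v := by
  have h := (mem_riemannRochSpace_iff_adicVal D x).1 hx v
  rwa [← log_le_iff_le_exp ((((maximalIdeal v.toValuationSubring).valuation F).ne_zero_iff).2 hx0)] at h

/-- Converse direction in logarithmic form: if `x ≠ 0` and `log (𝓋_v x) ≤ D v` for every place
`v` (i.e. `v_P(x) ≥ -v_P(D)`), then `x ∈ L(D)` (Stichtenoth Def. 1.4.4 / Remark 1.4.5 (a)).
[cite: Stichtenoth2009, Remark 1.4.5(a)] -/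
theorem mem_riemannRochSpace_of_log_adicVal_le {D : Divisor K F} {x : F} (hx0 : x ≠ 0)
    (h : ∀ v : PlaceOver K F, log (((maximalIdeal v.toValuationSubring).valuation F) x) ≤ D v) : x ∈ riemannRochSpace D := by
  rw [mem_riemannRochSpace_iff_adicVal]
  intro v
  rw [← log_le_iff_le_exp ((((maximalIdeal v.toValuationSubring).valuation F).ne_zero_iff).2 hx0)]
  exact h v

/-- For `x ≠ 0`: `x ∈ L(D) ↔ ∀ v, -D v ≤ ord_v x`, i.e. `(x) + D ≥ 0` (Stichtenoth Def. 1.4.4 /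
Remark 1.4.5 (a)); this is the statement of the named fact `mem_riemannRochSpace_iff_ord` of
`FunctionFieldDivisors`, obtained here from the adic description. [cite: Stichtenoth2009, Remark 1.4.5(a)] -/
theorem mem_riemannRochSpace_iff_neg_le_ord (D : Divisor K F) {x : F} (hx0 : x ≠ 0) :
    x ∈ riemannRochSpace D ↔ ∀ v : PlaceOver K F, -D v ≤ v.ord x := by
  constructor
  · intro hx v
    have := log_adicVal_le_of_mem hx hx0 v
    rw [v.ord_eq_neg_log_adicVal hx0]
    omega
  · intro h
    refine mem_riemannRochSpace_of_log_adicVal_le hx0 fun v ↦ ?_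
    have := h v
    rw [v.ord_eq_neg_log_adicVal hx0] at this
    omega

/-- Discharge of the named fact `mem_riemannRochSpace_iff_ord` of `FunctionFieldDivisors`
(Stichtenoth Def. 1.4.4 / Remark 1.4.5 (a): `x ∈ L(A) ↔ v_P(x) ≥ -v_P(A)` for all `P`, for
`x ≠ 0`). [cite: Stichtenoth2009, Remark 1.4.5(a)] -/
theorem mem_riemannRochSpace_iff_ord_holds : mem_riemannRochSpace_iff_ord (K := K) (F := F) :=
  fun D _ hx0 ↦ mem_riemannRochSpace_iff_neg_le_ord D hx0

/-- Off the junk case, the coefficient of the principal divisor `(x)` at `v` is `-log (𝓋_v x)`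
(`= v_P(x)`, Stichtenoth Def. 1.4.2 and (1.17): `(x) = ∑_P v_P(x) P`). [cite: Stichtenoth2009, Def. 1.4.2] -/
theorem principalDivisor_apply_eq_neg_log {x : F} (hx0 : x ≠ 0)
    (h : {v : PlaceOver K F | v.ord x ≠ 0}.Finite) (v : PlaceOver K F) :
    principalDivisor K x v = -log (((maximalIdeal v.toValuationSubring).valuation F) x) := by
  rw [principalDivisor_apply h, v.ord_eq_neg_log_adicVal hx0]

end Literature.NumberTheory.DiophantineGeometry.AlgFunctionField
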